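import Mathlib
import Literature.Analysis.FluidPDE.VectorCalculus
import Literature.Analysis.FluidPDE.AxisymmetricEuler
import Summits.NavierStokesRegularity.NavierStokesRegularity.Theorems.ThreadingFluxPoloidalLiouvillePrecessionSwirl
import HarnessLib

/-!
# Crux `PoloidalLiouville` (stmt-NavierStokesRegularity-1222, W1), crux idea «silent-shells» (ns-idea-15 g8):
# ingredient (I3) `NoSwirlOfUnthreadedAxisymmetric` — BY NAME

The sketch `Cruxes/PoloidalLiouville/SilentShellsSketch.lean` (v1.1) reduces its `LocalAxisTrigger0` to three ingredients
I1–I3 plus KNSS.  Ingredient (I3) — an axisymmetric `C²` divergence-free field whose vorticity is tangent to the spheres about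
the ORIGIN (a point of the axis) has no swirl — is the `c = 0` case of the landed swirl lemma
`ThreadingFluxPoloidalLiouvillePrecessionSwirl.unthreadedAxisymmetricNoSwirl` (K2-p2, precession card item (E); `C¹` suffices and
divergence-freeness is not used).  This file records the closure with the sketch's binder structure, body verbatim over the
Literature vocabulary (`IsAxisymmetric`, `HasNoSwirl`, `VectorCalculus.IsDivFree`; the sketch's local `IsUnthreadedAbout 0 V`
unfolds to `∀ x, ⟪x − 0, curl V x⟫ = 0`).  Bookkeeping only; NS regularity is NOT proved by any of this.
-/

-- the summit and its single problem share the name (D-0017 nested layout)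
set_option linter.dupNamespace false

noncomputable section

namespace Summit.NavierStokesRegularity.NavierStokesRegularity.Theorems.PoloidalLiouville.SilentShells

open scoped RealInnerProductSpace
open Literature.Analysis.FluidPDE

/-- **(I3) `NoSwirlOfUnthreadedAxisymmetric`** (silent-shells sketch l.514, body verbatim): an axisymmetric `C²` divergence-free
field on `ℝ³` whose vorticity is tangent to every sphere about the origin has no swirl. -/
theorem noSwirlOfUnthreadedAxisymmetric :
    ∀ V : EuclideanSpace ℝ (Fin 3) → EuclideanSpace ℝ (Fin 3), ContDiff ℝ 2 V → VectorCalculus.IsDivFree V →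
      IsAxisymmetric V → (∀ x, ⟪x - 0, curl V x⟫ = 0) → HasNoSwirl V := by
  intro V hV _ hax hun
  have h0 : EuclideanSpace.single (2 : Fin 3) (0 : ℝ) = (0 : EuclideanSpace ℝ (Fin 3)) := by
    ext i; fin_cases i <;> simp
  refine ThreadingFluxPoloidalLiouvillePrecessionSwirl.unthreadedAxisymmetricNoSwirl V 0 (hV.of_le (by norm_num)) hax ?_
  intro x
  rw [h0]
  exact hun x

end Summit.NavierStokesRegularity.NavierStokesRegularity.Theorems.PoloidalLiouville.SilentShells

end
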